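import Summits.Ventures.HodgeRepro.Night1AndreTwistedTrace

/-!
# The rank of the sign-twisted trace is the orbit length (normal basis theorem): each orbit piece of
Theorem 1 is `ℚ`-rational of `ℚ`-dimension `|G • Δ|`

Blind re-derivation cell `pub-hodge-repro`, seat `night-1` (gen 6).  Imports night-1's
`Night1AndreTwistedTrace` (the sign character `stabSign e h` of the stabiliser `H = Stab_G(Δ)` on `Δ`, the
sign-twisted trace `twistedTrace K e f = Σ_{h∈H} stabSign e h • h f`, and `ratPohlmann_eq_zero_iff`:
`f_Δ^*(ratWeil f) = 0 ⟺ Tr^{sgn}(f) = 0`).  Namespace `HodgeRepro.RouteC`.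

For a subgroup `H` of `G = Gal(K/ℚ)` and a multiplicative character `χ : H → ℤ` (`χ 1 = 1`, `χ(h h') = χ h · χ h'`,
values `±1`) the `χ`-twisted trace `T_χ f = Σ_h χ(h) h(f)` is a `ℚ`-linear endomorphism of `K`.  In a
NORMAL basis `b_g = g(θ)` (Mathlib's `IsGalois.normalBasis`: `g (b g') = b (g g')`) it sends `b_g` to the
`χ`-signed sum over the right coset `H g`, so its image is spanned by ONE vector per right coset, and these
are linearly independent (disjoint supports — separated by the coordinate functionals at the representatives):

* `twistedLin K H χ : K →ₗ[ℚ] K`, `twistedLin_apply`, `twistedLin_normalBasis` (`T_χ b_g = Σ_h χ(h) b_{h g}`);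
* `cosetVec K H χ q` — the vector of the right coset `q`; `linearIndependent_cosetVec` (`χ 1 = 1`);
* `range_twistedLin_eq_span` — `range T_χ = span {cosetVec q}` (`χ` multiplicative, `χ 1 = 1`);
* **`finrank_range_twistedLin`** — `finrank ℚ (range T_χ) = |H\G| = |G/H|`;
* `stabSign_one`, `stabSign_mul` — the sign character is a character;
  **`finrank_range_twistedLin_stabSign`** — for `H = Stab_G(Δ)` and `χ = stabSign e`:
  `finrank ℚ (range T^{sgn}) = |G • Δ|` (orbit–stabiliser), and `twistedTrace_eq_twistedLin` identifies
  `twistedTrace K e` with this `T^{sgn}`.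

With `ratPohlmann_eq_zero_iff` (file 11) the `ℚ`-linear map `K → f_Δ^*(W_F(A_Δ)) ⊗ ℂ`, `f ↦ f_Δ^*(ratWeil f)`, has
kernel `ker T^{sgn}`, hence an image of `ℚ`-dimension `[K : ℚ] − dim ker T^{sgn} = dim range T^{sgn} = |G • Δ|
= dim_ℂ f_Δ^*(W_F(A_Δ)) ⊗ ℂ` (`finrank_map_andrePull_weilSpaceProd`): EVERY orbit piece of Theorem 1 carries
a `ℚ`-form of the right dimension — the kernel form of «the Hodge classes of `A` are `ℚ`-rational classes
of the corner products, orbit by orbit».  The `ℚ`-module structure on `⋀^{2p} ℂ^X` is not set up here (the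
dimension statement is made on `K`).  Nothing geometric is built.  Nothing here says anything about the
status of the Hodge conjecture for CM abelian varieties, which is NOT proved.
-/

set_option autoImplicit false

open Finset Module
open scoped Pointwise Classical

namespace HodgeRepro.RouteC

open CMHodge CMHodgeOn

section Twisted

variable (K : Type*) [Field K] [NumberField K] [IsGalois ℚ K]
variable (H : Subgroup (K ≃ₐ[ℚ] K)) (χ : ↥H → ℤ)

/-- **The `χ`-twisted trace** `T_χ f = Σ_{h ∈ H} χ(h) h(f)` as a `ℚ`-linear endomorphism of `K`. -/
noncomputable def twistedLin : K →ₗ[ℚ] K :=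
  ∑ h : ↥H, (χ h : ℚ) • ((h : K ≃ₐ[ℚ] K).toLinearMap : K →ₗ[ℚ] K)

omit [IsGalois ℚ K] in
/-- The twisted trace, applied. -/
theorem twistedLin_apply (f : K) : twistedLin K H χ f = ∑ h : ↥H, (χ h : ℚ) • (h : K ≃ₐ[ℚ] K) f := by
  simp only [twistedLin, LinearMap.sum_apply, LinearMap.smul_apply, AlgEquiv.toLinearMap_apply]

/-- The normal basis of `K/ℚ` (Mathlib), indexed by `G = Gal(K/ℚ)`. -/
noncomputable def nb : Module.Basis (K ≃ₐ[ℚ] K) ℚ K := IsGalois.normalBasis ℚ K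

/-- The normal basis is an orbit: `g (b g') = b (g g')`. -/
theorem apply_nb (g g' : K ≃ₐ[ℚ] K) : g (nb K g') = nb K (g * g') := by
  rw [nb, IsGalois.normalBasis_apply g', IsGalois.normalBasis_apply (g * g'), AlgEquiv.mul_apply]

/-- `T_χ b_g = Σ_h χ(h) b_{h g}`. -/
theorem twistedLin_nb (g : K ≃ₐ[ℚ] K) :
    twistedLin K H χ (nb K g) = ∑ h : ↥H, (χ h : ℚ) • nb K ((h : K ≃ₐ[ℚ] K) * g) := by
  rw [twistedLin_apply]
  simp only [apply_nb]

/-- The vector of a right coset `H g`: `Σ_h χ(h) b_{h ḡ}` at the representative `ḡ = q.out`. -/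
noncomputable def cosetVec (q : Quotient (QuotientGroup.rightRel H)) : K :=
  ∑ h : ↥H, (χ h : ℚ) • nb K ((h : K ≃ₐ[ℚ] K) * q.out)

/-- The coset vector is `T_χ` of the basis vector at the representative. -/
theorem cosetVec_eq (q : Quotient (QuotientGroup.rightRel H)) :
    cosetVec K H χ q = twistedLin K H χ (nb K q.out) := by
  rw [cosetVec, twistedLin_nb]

/-- The coordinate at `g'` of `T_χ b_g`: `χ(h)` if `g' = h g` for (the unique) `h ∈ H`, `0` otherwise. -/
theorem coord_twistedLin_nb (g g' : K ≃ₐ[ℚ] K) :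
    (nb K).coord g' (twistedLin K H χ (nb K g)) =
      ∑ h : ↥H, if g' = (h : K ≃ₐ[ℚ] K) * g then (χ h : ℚ) else 0 := by
  rw [twistedLin_nb, map_sum]
  refine Finset.sum_congr rfl fun h _ => ?_
  rw [map_smul, Module.Basis.coord_apply, Module.Basis.repr_self_apply, smul_eq_mul]
  by_cases hg : g' = (h : K ≃ₐ[ℚ] K) * g
  · rw [if_pos hg, if_pos hg.symm, mul_one]
  · rw [if_neg hg, if_neg (Ne.symm hg), mul_zero]

/-- The coordinate of `cosetVec q` at its own representative is `χ(1) = 1`. -/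
theorem coord_cosetVec_self (hχ1 : χ 1 = 1) (q : Quotient (QuotientGroup.rightRel H)) :
    (nb K).coord q.out (cosetVec K H χ q) = 1 := by
  rw [cosetVec_eq, coord_twistedLin_nb, Finset.sum_eq_single (1 : ↥H)]
  · rw [if_pos (by simp), hχ1, Int.cast_one]
  · intro h _ hh
    rw [if_neg]
    intro heq
    apply hh
    apply Subtype.ext
    have : (h : K ≃ₐ[ℚ] K) * q.out = 1 * q.out := by rw [one_mul, ← heq]
    exact mul_right_cancel this
  · intro h
    exact absurd (Finset.mem_univ _) h

/-- The coordinate of `cosetVec q'` at the representative of another coset `q` is `0`. -/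
theorem coord_cosetVec_of_ne {q q' : Quotient (QuotientGroup.rightRel H)} (hne : q ≠ q') :
    (nb K).coord q.out (cosetVec K H χ q') = 0 := by
  rw [cosetVec_eq, coord_twistedLin_nb]
  refine Finset.sum_eq_zero fun h _ => ?_
  rw [if_neg]
  intro heq
  apply hne
  rw [← Quotient.out_eq q, ← Quotient.out_eq q']
  refine Quotient.sound ((QuotientGroup.rightRel_apply).2 ?_)
  rw [heq, mul_inv_rev, mul_inv_cancel_left]
  exact H.inv_mem h.2

/-- **The coset vectors are linearly independent** (`χ 1 = 1`). -/
theorem linearIndependent_cosetVec (hχ1 : χ 1 = 1) : LinearIndependent ℚ (cosetVec K H χ) :=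
  LinearIndependent.of_pairwise_dual_eq_zero_one _ (fun q => (nb K).coord q.out)
    (fun _ _ hne => coord_cosetVec_of_ne K H χ hne) (fun q => coord_cosetVec_self K H χ hχ1 q)

/-- `T_χ b_g` is `± cosetVec q` for the right coset `q` of `g` (`χ` multiplicative). -/
theorem twistedLin_nb_eq_smul_cosetVec (hχ : ∀ h h' : ↥H, χ (h * h') = χ h * χ h') (g : K ≃ₐ[ℚ] K) :
    ∃ c : ℚ, twistedLin K H χ (nb K g) = c • cosetVec K H χ (Quotient.mk _ g) := by
  set q : Quotient (QuotientGroup.rightRel H) := Quotient.mk _ g with hq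
  have hrel : QuotientGroup.rightRel H q.out g := Quotient.exact (by rw [Quotient.out_eq, hq])
  rw [QuotientGroup.rightRel_apply] at hrel
  set h₀ : ↥H := ⟨g * q.out⁻¹, hrel⟩ with hh₀
  have hg : g = (h₀ : K ≃ₐ[ℚ] K) * q.out := by
    show g = (g * q.out⁻¹) * q.out
    rw [inv_mul_cancel_right]
  refine ⟨(χ h₀⁻¹ : ℚ), ?_⟩
  rw [twistedLin_nb, cosetVec, Finset.smul_sum, ← Equiv.sum_comp (Equiv.mulRight h₀⁻¹)]
  refine Finset.sum_congr rfl fun h _ => ?_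
  have harg : ((h * h₀⁻¹ : ↥H) : K ≃ₐ[ℚ] K) * g = (h : K ≃ₐ[ℚ] K) * q.out := by
    rw [hg, Subgroup.coe_mul, Subgroup.coe_inv, mul_assoc, inv_mul_cancel_left]
  simp only [Equiv.coe_mulRight]
  rw [harg, hχ, Int.cast_mul, mul_comm, ← smul_smul]

/-- **The range of `T_χ` is the span of the coset vectors.** -/
theorem range_twistedLin_eq_span (hχ : ∀ h h' : ↥H, χ (h * h') = χ h * χ h') :
    LinearMap.range (twistedLin K H χ) = Submodule.span ℚ (Set.range (cosetVec K H χ)) := by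
  refine le_antisymm ?_ ?_
  · rw [LinearMap.range_eq_map, ← (nb K).span_eq, Submodule.map_span, Submodule.span_le]
    rintro _ ⟨_, ⟨g, rfl⟩, rfl⟩
    obtain ⟨c, hc⟩ := twistedLin_nb_eq_smul_cosetVec K H χ hχ g
    rw [SetLike.mem_coe, hc]
    exact Submodule.smul_mem _ _ (Submodule.subset_span ⟨_, rfl⟩)
  · rw [Submodule.span_le]
    rintro _ ⟨q, rfl⟩
    exact ⟨nb K q.out, (cosetVec_eq K H χ q).symm⟩

/-- **`rank T_χ = |G/H|`**: the number of (right = left) cosets of `H`. -/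
theorem finrank_range_twistedLin (hχ1 : χ 1 = 1) (hχ : ∀ h h' : ↥H, χ (h * h') = χ h * χ h') :
    finrank ℚ (LinearMap.range (twistedLin K H χ)) = Nat.card ((K ≃ₐ[ℚ] K) ⧸ H) := by
  rw [range_twistedLin_eq_span K H χ hχ, finrank_span_eq_card (linearIndependent_cosetVec K H χ hχ1),
    ← Nat.card_eq_fintype_card, Nat.card_congr (QuotientGroup.quotientRightRelEquivQuotientLeftRel H)]

end Twisted

/-! ### The sign character of the stabiliser is a character, and the rank of `Tr^{sgn}` is the orbit length -/

section Sign

variable {G : Type*} [Group G] {X : Type*} [MulAction G X] [DecidableEq X]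

/-- `indPerm` is a homomorphism. -/
theorem indPerm_mul {n : ℕ} {Δ : Finset X} (e : Fin n ≃ ↥Δ) (h h' : ↥(MulAction.stabilizer G Δ)) :
    indPerm e (h * h') = indPerm e h * indPerm e h' := by
  refine Equiv.ext fun j => ?_
  apply e.injective
  apply Subtype.ext
  rw [Equiv.Perm.mul_apply, coe_apply_indPerm, coe_apply_indPerm, coe_apply_indPerm, Subgroup.coe_mul,
    mul_smul]

/-- `indPerm` at `1` is the identity. -/
theorem indPerm_one {n : ℕ} {Δ : Finset X} (e : Fin n ≃ ↥Δ) : indPerm e (1 : ↥(MulAction.stabilizer G Δ)) = 1 := by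
  refine Equiv.ext fun j => ?_
  apply e.injective
  apply Subtype.ext
  rw [coe_apply_indPerm, Equiv.Perm.one_apply, Subgroup.coe_one, one_smul]

/-- `stabSign 1 = 1`. -/
theorem stabSign_one {n : ℕ} {Δ : Finset X} (e : Fin n ≃ ↥Δ) :
    stabSign e (1 : ↥(MulAction.stabilizer G Δ)) = 1 := by
  rw [stabSign, indPerm_one, Equiv.Perm.sign_one, Units.val_one]

/-- `stabSign` is multiplicative. -/
theorem stabSign_mul {n : ℕ} {Δ : Finset X} (e : Fin n ≃ ↥Δ) (h h' : ↥(MulAction.stabilizer G Δ)) :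
    stabSign e (h * h') = stabSign e h * stabSign e h' := by
  rw [stabSign, stabSign, stabSign, indPerm_mul, Equiv.Perm.sign_mul, Units.val_mul]

end Sign

section Rank

variable (K : Type*) [Field K] [NumberField K] [IsGalois ℚ K]
variable {X : Type*} [MulAction (K ≃ₐ[ℚ] K) X] [Fintype X] [DecidableEq X]

omit [IsGalois ℚ K] [Fintype X] in
/-- `twistedTrace K e` is the `ℚ`-linear twisted trace for `χ = stabSign e`. -/
theorem twistedTrace_eq_twistedLin {n : ℕ} {Δ : Finset X} (e : Fin n ≃ ↥Δ) (f : K) :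
    twistedTrace K e f = twistedLin K (MulAction.stabilizer (K ≃ₐ[ℚ] K) Δ) (stabSign e) f := by
  rw [twistedTrace, twistedLin_apply]
  refine Finset.sum_congr (by congr; exact funext fun _ => Subsingleton.elim _ _) fun h _ => ?_
  rw [Int.cast_smul_eq_zsmul]

/-- **`rank Tr^{sgn} = |G • Δ|`**: the sign-twisted trace to the fixed field of the stabiliser of `Δ` has rank
the length of the Galois orbit of `Δ` (orbit–stabiliser). -/
theorem finrank_range_twistedLin_stabSign {n : ℕ} (Δ : Finset X) (e : Fin n ≃ ↥Δ) :
    finrank ℚ (LinearMap.range (twistedLin K (MulAction.stabilizer (K ≃ₐ[ℚ] K) Δ) (stabSign e))) =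
      (orbitSets (G := K ≃ₐ[ℚ] K) Δ).card := by
  rw [finrank_range_twistedLin K _ _ (stabSign_one e) (stabSign_mul e),
    Nat.card_congr (MulAction.orbitEquivQuotientStabilizer (K ≃ₐ[ℚ] K) Δ).symm, Nat.card_eq_fintype_card,
    ← Set.toFinset_card, toFinset_orbit_eq_orbitSets]

end Rank

end HodgeRepro.RouteC
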